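import Literature.Computability.Complexity.ArthurMerlinGamesProofs
import Literature.Computability.Complexity.ArthurMerlinParallelPlay
import Literature.Computability.Complexity.ListFoldBricks
import Literature.Computability.Complexity.FoldBricks
import Literature.Computability.Complexity.PlumbingBricks
import Literature.Computability.Complexity.ReductionsProofs
import HarnessLib

/-!
# Arthur–Merlin games: the polynomial-time referee of a game played on many boards

Machine half of the proof of Babai–Moran's constant-round Collapse Theorem
(`Literature.Computability.Complexity.BabaiMoran1988_collapse`; the value half is `ArthurMerlinParallelPlay.lean`): the
referee of a simulating game "acts in polynomial time, using the old referee as an oracle"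
(Babai–Moran 1988, §2.5), for the two simulations the collapse uses — playing "in parallel on
several boards and declaring [Merlin] the winner if he wins on more than half of the boards"
(§2.6, Prop. 7) and the switch of an `MA` segment into an `AM` segment in which "the old
deterministic referee is being fed the moves `(x, yᵢ, zᵢ)`" of board `i` (§3) — written in the
tree's algebra of `FP` string functions (`BrickAlgebra.lean`, `PlumbingBricks.lean`,
`ListFoldBricks.lean`, `FoldBricks.lean`): no Turing machine is programmed here.

The referee of a game reads `⟨x, enc h⟩` with `enc h = ⟨1^{|h|}, encList h⟩` (`encMoves_eq`), all
moves of one length `M(|x|)`. Board `i` of a move `W` is its block `W[i·m, (i+1)·m)`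
(`Literature.Computability.Complexity.block`). The simulating referee `Boards.refSim Ref m s t μ d` (parameters: the old
referee `Ref`, the old move length `m`, the number of boards `s`, the threshold `t` — all
polynomials in `|x|` — a mode `μ` and a header shift `d`) runs, for `i < s(|x|)`, the old referee
on board `i`'s history and accepts iff at least `t(|x|)` boards accept; board `i`'s history is
`pre_i ++ (C.map (block m i))` where `C` are the board-split moves and the prefix `pre_i` is empty
(mode `0`: plain parallel play), `[U₀, X₀, U_{i+1}]` (mode `3`) or `[U₀, X₀, U_{i+1}, X_{i+1}]`
(mode `4`) for the two leading special moves `U`, `X` of the new history (the switch: Arthur's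
merged move `U = y₁·(y₂⁽ⁱ⁾)ᵢ`, Merlin's merged move `X = x·(z⁽ⁱ⁾)ᵢ`).

* strings: `boolPair_append`, `encList_append` (the list code is a concatenation code),
  `encMoves_eq`, length lemmas (`length_encList` of `StackLists.lean` reused). Local copies, NOT
  importable here with a minimal import (librarian consolidation candidates, flagged by the
  dedup linter): `Boards.boolPair_append` = `Literature.Computability.Cryptography.boolPair_append` (`ShorProofs.lean`),
  `Boards.encList_append` = `Literature.Computability.MetaComplexity.FregeTransl.encList_append` (`FregeTranslation.lean`)
  (`OracleCompose.unaryEncodeNat_eq_replicate`, which IS in the closure, is reused); likewise `block` of `ArthurMerlinParallelPlay.lean` vs `HashBricks.blk` (noted by its reviewer);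
* `Boards.mapTakeF` / `Boards.mapDropF` — `take m` / `drop m` mapped over a coded list (instances
  of `Brick.foldFn`), with their values and `FP` membership;
* the board loop: record `⟨w, ⟨cnt, ⟨count, ⟨uRest, ⟨xRest, cRest⟩⟩⟩⟩⟩`, body `Boards.bodyF`
  (vote of the current board via the old referee's indicator, `indicatorFn_mem_FP`; then shift
  every unread move by one block), `Boards.length_bodyF_le` (linear growth, the new `cRest`
  clipped to `|w|`) and `Boards.loop_mem_FP` (`Brick.loopFn_mem_FP`); its semantics
  `Boards.bodyF_St` / `Boards.loopModel_St` on the states `Boards.St j` (after `j` boards);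
* `Boards.refSim`, **`Boards.refSim_mem_P`**, and its semantics **`Boards.mem_refSim_iff`** with
  the two user forms `Boards.mem_refSim_zero_iff` (plain) and `Boards.mem_refSim_special_iff`
  (switch modes): accepted iff `t(|x|) ≤ #{i < s(|x|) | board i accepted}`.

## References

* L. Babai, S. Moran, *Arthur–Merlin games: a randomized proof system, and a hierarchy of
  complexity classes*, J. Comput. System Sci. 36 (1988) 254–276, §2.5 (simulation: "the new
  referee acts in polynomial time, using the old referee as an oracle"), §2.6 (parallel play,
  Prop. 7), §3 (switching moves).
* S. Arora, B. Barak, *Computational Complexity: A Modern Approach*, CUP 2009, §1.3 (closure of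
  polynomial time under composition and bounded loops), §0.1 (coding of tuples and lists).
-/

noncomputable section

namespace Literature.Computability.Complexity

open _root_.Computability Brick Plumb Polynomial Kannan

open scoped Classical

namespace Boards

/-! ### Strings: concatenating coded lists, the move-list code -/

/-- `⟨a, y⟩ s = ⟨a, y s⟩`: the pair code is a prefix code in its first component. [folklore] -/
theorem boolPair_append (a y s : List Bool) : boolPair a y ++ s = boolPair a (y ++ s) := by
  rw [boolPair_eq, boolPair_eq]; simp

/-- **The list code is a concatenation code**: `encList (l ++ l') = encList l ++ encList l'`.
[folklore] -/
theorem encList_append (l l' : List (List Bool)) : encList (l ++ l') = encList l ++ encList l' := by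
  induction l with
  | nil => simp
  | cons a l ih => rw [List.cons_append, encList_cons, encList_cons, ih, boolPair_append]

/-- The code of a one-item list. [folklore] -/
theorem encList_singleton (a : List Bool) : encList [a] = boolPair a [] := rfl

/-- The referee's move-list code is the unary length followed by the nested-pair code:
`enc h = ⟨1^{|h|}, encList h⟩`. [folklore] -/
theorem encMoves_eq (h : List (List Bool)) : encMoves h = boolPair (ones h.length) (encList h) := by
  have hfold : ∀ l : List (List Bool),
      l.foldr (fun a acc => boolPair ((encodingList Bool).encode a) acc) [] = encList l := by
    intro l
    induction l with
    | nil => rfl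
    | cons a l ih => rw [List.foldr_cons, ih]; rfl
  show boolPair (unaryEncodeNat h.length) (h.foldr (fun a acc => boolPair ((encodingList Bool).encode a) acc) []) = _
  rw [hfold, OracleCompose.unaryEncodeNat_eq_replicate]

/-- Shortening every item does not lengthen the code. [folklore] -/
theorem length_encList_map_le (l : List (List Bool)) (g : List Bool → List Bool)
    (hg : ∀ a, (g a).length ≤ a.length) : (encList (l.map g)).length ≤ (encList l).length := by
  rw [length_encList, length_encList, List.map_map]
  exact List.sum_le_sum fun a _ => by dsimp only [Function.comp_apply]; have := hg a; omega

/-- A suffix of a coded list is no longer than the code. [folklore] -/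
theorem length_encList_drop_le (l : List (List Bool)) (i : ℕ) :
    (encList (l.drop i)).length ≤ (encList l).length := by
  rw [length_encList, length_encList]
  exact List.Sublist.sum_le_sum (List.Sublist.map _ (List.drop_sublist i l)) fun _ _ => Nat.zero_le _

/-! ### Mapping `take m` / `drop m` over a coded list (folds) -/

/-- Step of the `take` map: `⟨⟨u, L⟩, ⟨a, acc⟩⟩ ↦ acc ⟨a ↾ |u|, ε⟩`. [folklore] -/
def takeStep : List Bool → List Bool :=
  appF ∘ fanoutFn (sndPow 1) (fanoutFn (takeFn ∘ fanoutFn (fstF ∘ fstF) (nthF 1)) fun _ => [])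

/-- Step of the `drop` map: `⟨⟨u, L⟩, ⟨a, acc⟩⟩ ↦ acc ⟨a ⇂ |u|, ε⟩`. [folklore] -/
def dropStep : List Bool → List Bool :=
  appF ∘ fanoutFn (sndPow 1) (fanoutFn (dropFn ∘ fanoutFn (fstF ∘ fstF) (nthF 1)) fun _ => [])

/-- `takeStep` on a step argument. [folklore] -/
@[simp] theorem takeStep_apply (u L a acc : List Bool) :
    takeStep (boolPair (boolPair u L) (boolPair a acc)) = acc ++ boolPair (a.take u.length) [] := by
  simp [takeStep, nthF, sndPow]

/-- `dropStep` on a step argument. [folklore] -/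
@[simp] theorem dropStep_apply (u L a acc : List Bool) :
    dropStep (boolPair (boolPair u L) (boolPair a acc)) = acc ++ boolPair (a.drop u.length) [] := by
  simp [dropStep, nthF, sndPow]

/-- `takeStep ∈ FP`. [folklore] -/
theorem takeStep_mem_FP : takeStep ∈ FP :=
  comp_mem_FP appF_mem_FP (fanoutFn_mem_FP (sndPow_mem_FP 1) (fanoutFn_mem_FP
    (comp_mem_FP takeFn_mem_FP (fanoutFn_mem_FP (comp_mem_FP fstF_mem_FP fstF_mem_FP) (nthF_mem_FP 1)))
    (const_mem_FP [])))

/-- `dropStep ∈ FP`. [folklore] -/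
theorem dropStep_mem_FP : dropStep ∈ FP :=
  comp_mem_FP appF_mem_FP (fanoutFn_mem_FP (sndPow_mem_FP 1) (fanoutFn_mem_FP
    (comp_mem_FP dropFn_mem_FP (fanoutFn_mem_FP (comp_mem_FP fstF_mem_FP fstF_mem_FP) (nthF_mem_FP 1)))
    (const_mem_FP [])))

/-- The value of `takeStep` on every input (through the total projections). [folklore] -/
theorem takeStep_eq (v : List Bool) :
    takeStep v = sndPow 1 v ++ boolPair ((nthF 1 v).take (fstF (fstF v)).length) [] := by
  have hv : takeFn (boolPair (fstF (fstF v)) (nthF 1 v)) = (nthF 1 v).take (fstF (fstF v)).length :=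
    takeFn_boolPair _ _
  simp [takeStep, hv]

/-- The value of `dropStep` on every input. [folklore] -/
theorem dropStep_eq (v : List Bool) :
    dropStep v = sndPow 1 v ++ boolPair ((nthF 1 v).drop (fstF (fstF v)).length) [] := by
  have hv : dropFn (boolPair (fstF (fstF v)) (nthF 1 v)) = (nthF 1 v).drop (fstF (fstF v)).length :=
    dropFn_boolPair _ _
  simp [dropStep, hv]

/-- Growth of `takeStep`: `FoldGrowth 2`. [folklore] -/
theorem foldGrowth_takeStep : FoldGrowth 2 takeStep := fun v => by
  rw [takeStep_eq, List.length_append, length_boolPair]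
  have h1 : ((nthF 1 v).take (fstF (fstF v)).length).length ≤ (fstF (sndF v)).length := by
    rw [show nthF 1 v = fstF (sndF v) from rfl, List.length_take]; exact min_le_right _ _
  simp only [sndPow, nthF, Function.comp_apply, List.length_nil] at h1 ⊢
  omega

/-- Growth of `dropStep`: `FoldGrowth 2`. [folklore] -/
theorem foldGrowth_dropStep : FoldGrowth 2 dropStep := fun v => by
  rw [dropStep_eq, List.length_append, length_boolPair]
  have h1 : ((nthF 1 v).drop (fstF (fstF v)).length).length ≤ (fstF (sndF v)).length := by
    rw [show nthF 1 v = fstF (sndF v) from rfl, List.length_drop]; exact Nat.sub_le _ _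
  simp only [sndPow, nthF, Function.comp_apply, List.length_nil] at h1 ⊢
  omega

/-- **`mapTakeF ⟨u, encList l⟩ = encList (l.map (· ↾ |u|))`**: truncate every item of a coded
list to `|u|` symbols. [folklore] -/
def mapTakeF : List Bool → List Bool := foldFn takeStep fun _ => []

/-- **`mapDropF ⟨u, encList l⟩ = encList (l.map (· ⇂ |u|))`**: drop `|u|` symbols from every item
of a coded list. [folklore] -/
def mapDropF : List Bool → List Bool := foldFn dropStep fun _ => []

/-- `mapTakeF ∈ FP`. [folklore] -/
theorem mapTakeF_mem_FP : mapTakeF ∈ FP := foldFn_mem_FP takeStep_mem_FP (const_mem_FP []) foldGrowth_takeStep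

/-- `mapDropF ∈ FP`. [folklore] -/
theorem mapDropF_mem_FP : mapDropF ∈ FP := foldFn_mem_FP dropStep_mem_FP (const_mem_FP []) foldGrowth_dropStep

/-- The value of `mapTakeF` on a coded list. [folklore] -/
@[simp] theorem mapTakeF_apply (u : List Bool) (l : List (List Bool)) :
    mapTakeF (boolPair u (encList l)) = encList (l.map fun a => a.take u.length) := by
  rw [mapTakeF, foldFn_boolPair, decNil_encList]
  have key : ∀ (l' : List (List Bool)) (acc : List Bool),
      l'.foldl (fun acc a => takeStep (boolPair (boolPair u (encList l)) (boolPair a acc))) acc =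
        acc ++ encList (l'.map fun a => a.take u.length) := by
    intro l'
    induction l' with
    | nil => intro acc; simp
    | cons a l' ih =>
      intro acc
      rw [List.foldl_cons, takeStep_apply, ih, List.map_cons, encList_cons, List.append_assoc,
        boolPair_append, List.nil_append]
  rw [key]; rfl

/-- The value of `mapDropF` on a coded list. [folklore] -/
@[simp] theorem mapDropF_apply (u : List Bool) (l : List (List Bool)) :
    mapDropF (boolPair u (encList l)) = encList (l.map fun a => a.drop u.length) := by
  rw [mapDropF, foldFn_boolPair, decNil_encList]
  have key : ∀ (l' : List (List Bool)) (acc : List Bool),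
      l'.foldl (fun acc a => dropStep (boolPair (boolPair u (encList l)) (boolPair a acc))) acc =
        acc ++ encList (l'.map fun a => a.drop u.length) := by
    intro l'
    induction l' with
    | nil => intro acc; simp
    | cons a l' ih =>
      intro acc
      rw [List.foldl_cons, dropStep_apply, ih, List.map_cons, encList_cons, List.append_assoc,
        boolPair_append, List.nil_append]
  rw [key]; rfl

/-! ### The board loop: accessors of the loop record -/

/-- Prepending `d` ones (`1ᵈ s`). [folklore] -/
def consOnes : ℕ → List Bool → List Bool
  | 0 => id
  | d + 1 => List.cons true ∘ consOnes d

/-- `consOnes d s = 1ᵈ ++ s`. [folklore] -/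
@[simp] theorem consOnes_apply (d : ℕ) (s : List Bool) : consOnes d s = ones d ++ s := by
  induction d with
  | zero => rfl
  | succ d ih => simp [consOnes, ih, ones, List.replicate_succ]

/-- `consOnes d ∈ FP`. [folklore] -/
theorem consOnes_mem_FP : ∀ d : ℕ, consOnes d ∈ FP
  | 0 => PolyTimeComputable.id _
  | d + 1 => comp_mem_FP (cons_mem_FP true) (consOnes_mem_FP d)

section Loop

variable (Ref : Language Bool) (m : Polynomial ℕ) (μ d : ℕ)

/-! The loop record is `z = ⟨w, ⟨cnt, st⟩⟩` with the referee input `w = ⟨x, ⟨hdr, bdy⟩⟩` (kept),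
the binary countdown `cnt` of `loopStep`, and the state `st = ⟨count, ⟨uRest, ⟨xRest, cRest⟩⟩⟩`:
the number of boards won so far (binary), the unread parts of the two special moves `U = bdy[0]`,
`X = bdy[1]`, and the coded list of the unread parts of the remaining moves. -/

/-- The input `x` of the referee input `w`. [folklore] -/
def xF : List Bool → List Bool := fstF ∘ nthF 0
/-- The unary move length `1^{m(|x|)}`. [folklore] -/
def mhatF : List Bool → List Bool := polyFn m ∘ xF
/-- The old first move of Arthur, `bdy[0] ↾ m`. [folklore] -/
def u0F : List Bool → List Bool := takeFn ∘ fanoutFn (mhatF m) (nthF 2 ∘ nthF 0)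
/-- The old move of Merlin, `bdy[1] ↾ m`. [folklore] -/
def x0F : List Bool → List Bool := takeFn ∘ fanoutFn (mhatF m) (nthF 3 ∘ nthF 0)
/-- The current block of `U`: `uRest ↾ m`. [folklore] -/
def y2F : List Bool → List Bool := takeFn ∘ fanoutFn (mhatF m) (nthF 3)
/-- The current block of `X`: `xRest ↾ m`. [folklore] -/
def z2F : List Bool → List Bool := takeFn ∘ fanoutFn (mhatF m) (nthF 4)
/-- The current blocks of the remaining moves: `mapTakeF ⟨1^m, cRest⟩`. [folklore] -/
def headsF : List Bool → List Bool := mapTakeF ∘ fanoutFn (mhatF m) (sndPow 4)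

/-- The coded prefix of the current board's history, by mode: `μ = 3`: `[u₀, x₀, y₂]`;
`μ = 4`: `[u₀, x₀, y₂, z₂]`; otherwise empty. [cite: BabaiMoran1988, §3 (the moves `(x, yᵢ, zᵢ)` fed to the old referee)] -/
def preF : ℕ → List Bool → List Bool
  | 3 => fanoutFn (u0F m) (fanoutFn (x0F m) (fanoutFn (y2F m) fun _ => []))
  | 4 => fanoutFn (u0F m) (fanoutFn (x0F m) (fanoutFn (y2F m) (fanoutFn (z2F m) fun _ => [])))
  | _ => fun _ => []

/-- The old referee's input for the current board: `⟨x, ⟨1ᵈ hdr, pre ++ heads⟩⟩`.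
[cite: BabaiMoran1988, §3] -/
def voteArgF : List Bool → List Bool :=
  fanoutFn xF (fanoutFn (consOnes d ∘ nthF 1 ∘ nthF 0) (appF ∘ fanoutFn (preF m μ) (headsF m)))

/-- The vote of the current board: `[voteArg ∈ Ref]`. [cite: BabaiMoran1988, §2.6] -/
def voteF : List Bool → List Bool := (fun v => encodeBool (Ref.boolIndicator v)) ∘ voteArgF m μ d

/-- **The body of the board loop**: the new state
`⟨count + vote, ⟨uRest ⇂ m, ⟨xRest ⇂ m, (mapDropF ⟨1^m, cRest⟩) ↾ |w|⟩⟩⟩`.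
[cite: BabaiMoran1988, §2.6] -/
def bodyF : List Bool → List Bool :=
  fanoutFn (addFn ∘ fanoutFn (nthF 2) (voteF Ref m μ d))
    (fanoutFn (dropFn ∘ fanoutFn (mhatF m) (nthF 3))
      (fanoutFn (dropFn ∘ fanoutFn (mhatF m) (nthF 4))
        (takeFn ∘ fanoutFn (nthF 0) (mapDropF ∘ fanoutFn (mhatF m) (sndPow 4)))))

/-! ### Polynomial time of the body and of the loop -/

/-- `xF ∈ FP`. [folklore] -/
theorem xF_mem_FP : xF ∈ FP := comp_mem_FP fstF_mem_FP (nthF_mem_FP 0)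
/-- `mhatF ∈ FP`. [folklore] -/
theorem mhatF_mem_FP : mhatF m ∈ FP := comp_mem_FP (polyFn_mem_FP m) xF_mem_FP
/-- `u0F ∈ FP`. [folklore] -/
theorem u0F_mem_FP : u0F m ∈ FP :=
  comp_mem_FP takeFn_mem_FP (fanoutFn_mem_FP (mhatF_mem_FP m) (comp_mem_FP (nthF_mem_FP 2) (nthF_mem_FP 0)))
/-- `x0F ∈ FP`. [folklore] -/
theorem x0F_mem_FP : x0F m ∈ FP :=
  comp_mem_FP takeFn_mem_FP (fanoutFn_mem_FP (mhatF_mem_FP m) (comp_mem_FP (nthF_mem_FP 3) (nthF_mem_FP 0)))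
/-- `y2F ∈ FP`. [folklore] -/
theorem y2F_mem_FP : y2F m ∈ FP :=
  comp_mem_FP takeFn_mem_FP (fanoutFn_mem_FP (mhatF_mem_FP m) (nthF_mem_FP 3))
/-- `z2F ∈ FP`. [folklore] -/
theorem z2F_mem_FP : z2F m ∈ FP :=
  comp_mem_FP takeFn_mem_FP (fanoutFn_mem_FP (mhatF_mem_FP m) (nthF_mem_FP 4))
/-- `headsF ∈ FP`. [folklore] -/
theorem headsF_mem_FP : headsF m ∈ FP :=
  comp_mem_FP mapTakeF_mem_FP (fanoutFn_mem_FP (mhatF_mem_FP m) (sndPow_mem_FP 4))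
/-- `preF ∈ FP`. [folklore] -/
theorem preF_mem_FP : ∀ μ : ℕ, preF m μ ∈ FP
  | 3 => fanoutFn_mem_FP (u0F_mem_FP m) (fanoutFn_mem_FP (x0F_mem_FP m)
      (fanoutFn_mem_FP (y2F_mem_FP m) (const_mem_FP [])))
  | 4 => fanoutFn_mem_FP (u0F_mem_FP m) (fanoutFn_mem_FP (x0F_mem_FP m)
      (fanoutFn_mem_FP (y2F_mem_FP m) (fanoutFn_mem_FP (z2F_mem_FP m) (const_mem_FP []))))
  | 0 => const_mem_FP []
  | 1 => const_mem_FP []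
  | 2 => const_mem_FP []
  | _ + 5 => const_mem_FP []
/-- `voteArgF ∈ FP`. [folklore] -/
theorem voteArgF_mem_FP : voteArgF m μ d ∈ FP :=
  fanoutFn_mem_FP xF_mem_FP (fanoutFn_mem_FP
    (comp_mem_FP (consOnes_mem_FP d) (comp_mem_FP (nthF_mem_FP 1) (nthF_mem_FP 0)))
    (comp_mem_FP appF_mem_FP (fanoutFn_mem_FP (preF_mem_FP m μ) (headsF_mem_FP m))))

variable {Ref} in
/-- `voteF ∈ FP` for `Ref ∈ P`. [folklore] -/
theorem voteF_mem_FP (hRef : Ref ∈ Classes.P) : voteF Ref m μ d ∈ FP :=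
  comp_mem_FP (indicatorFn_mem_FP hRef) (voteArgF_mem_FP m μ d)

variable {Ref} in
/-- `bodyF ∈ FP` for `Ref ∈ P`. [folklore] -/
theorem bodyF_mem_FP (hRef : Ref ∈ Classes.P) : bodyF Ref m μ d ∈ FP :=
  fanoutFn_mem_FP (comp_mem_FP addFn_mem_FP (fanoutFn_mem_FP (nthF_mem_FP 2) (voteF_mem_FP m μ d hRef)))
    (fanoutFn_mem_FP (comp_mem_FP dropFn_mem_FP (fanoutFn_mem_FP (mhatF_mem_FP m) (nthF_mem_FP 3)))
      (fanoutFn_mem_FP (comp_mem_FP dropFn_mem_FP (fanoutFn_mem_FP (mhatF_mem_FP m) (nthF_mem_FP 4)))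
        (comp_mem_FP takeFn_mem_FP (fanoutFn_mem_FP (nthF_mem_FP 0)
          (comp_mem_FP mapDropF_mem_FP (fanoutFn_mem_FP (mhatF_mem_FP m) (sndPow_mem_FP 4)))))))

/-- The vote is one bit, on every input. [folklore] -/
theorem length_voteF (v : List Bool) : (voteF Ref m μ d v).length = 1 := by
  simp [voteF, encodeBool]

/-- **Growth of the body**: `|bodyF z| ≤ |st| + 12 (|w| + 1)` on every input (the count grows
by at most two symbols, `uRest`/`xRest` shrink, the new `cRest` is clipped to `|w|`).
[folklore] -/
theorem length_bodyF_le (z : List Bool) :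
    (bodyF Ref m μ d z).length ≤ (sndPow 1 z).length + 12 * ((fstF z).length + 1) := by
  have h2 : 2 * (nthF 2 z).length + (sndPow 2 z).length ≤ (sndPow 1 z).length :=
    length_nthF_succ_add_sndPow_succ_le 1 z
  have h3 : 2 * (nthF 3 z).length + (sndPow 3 z).length ≤ (sndPow 2 z).length :=
    length_nthF_succ_add_sndPow_succ_le 2 z
  have h4 : 2 * (nthF 4 z).length + (sndPow 4 z).length ≤ (sndPow 3 z).length :=
    length_nthF_succ_add_sndPow_succ_le 3 z
  -- the four new fields
  have hc : (addFn (boolPair (nthF 2 z) (voteF Ref m μ d z))).length ≤ (nthF 2 z).length + 2 := by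
    have := length_addFn_le (boolPair (nthF 2 z) (voteF Ref m μ d z))
    rw [fstF_boolPair, sndF_boolPair, length_voteF] at this
    omega
  have hu : (dropFn (boolPair (mhatF m z) (nthF 3 z))).length ≤ (nthF 3 z).length := by
    rw [dropFn_boolPair, List.length_drop]; exact Nat.sub_le _ _
  have hx : (dropFn (boolPair (mhatF m z) (nthF 4 z))).length ≤ (nthF 4 z).length := by
    rw [dropFn_boolPair, List.length_drop]; exact Nat.sub_le _ _
  have hr : (takeFn (boolPair (nthF 0 z) (mapDropF (boolPair (mhatF m z) (sndPow 4 z))))).length ≤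
      (fstF z).length := by
    rw [takeFn_boolPair, List.length_take, nthF_zero]; exact min_le_left _ _
  simp only [bodyF, fanoutFn_apply, Function.comp_apply, length_boolPair]
  omega

variable {Ref} in
/-- **The board loop is in `FP`**: `z ↦ (loopStep bodyF)^[s(|w|)] z` for `Ref ∈ P`.
[cite: AroraBarak2009, §1.3 (bounded loops)] -/
theorem loop_mem_FP (hRef : Ref ∈ Classes.P) (sB : Polynomial ℕ) :
    (fun z => (loopStep (bodyF Ref m μ d))^[sB.eval (fstF z).length] z) ∈ FP :=
  loopFn_mem_FP (bodyF_mem_FP m μ d hRef) (length_bodyF_le Ref m μ d) sB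

end Loop

/-! ### Semantics of the board loop on a well-formed record -/

section Semantics

variable (Ref : Language Bool) (m : Polynomial ℕ) (μ d : ℕ)
variable (x hdr bdy : List Bool) (C : List (List Bool))

/-- The old moves prefixed to board `i`'s history, by mode (`mh` = the move length `m(|x|)`,
`U`, `X` = the first two moves of the new history): mode `3`: `[U₀, X₀, U_{i+1}]`; mode `4`:
`[U₀, X₀, U_{i+1}, X_{i+1}]` (blocks of length `mh`); otherwise none.
[cite: BabaiMoran1988, §3 (the old referee "is being fed the moves `(x, yᵢ, zᵢ)`")] -/
def preList (mh : ℕ) (U X : List Bool) : ℕ → ℕ → List (List Bool)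
  | 3, i => [block mh 0 U, block mh 0 X, block mh (i + 1) U]
  | 4, i => [block mh 0 U, block mh 0 X, block mh (i + 1) U, block mh (i + 1) X]
  | _, _ => []

/-- **Board `i` is won**: the old referee accepts `⟨x, ⟨1ᵈ hdr, encList (pre_i ++ C.map (block i))⟩⟩`.
[cite: BabaiMoran1988, §2.6] -/
def Win (i : ℕ) : Prop :=
  Ref.boolIndicator (boolPair x (boolPair (ones d ++ hdr) (encList (preList (m.eval x.length) (fstF bdy) (fstF (sndF bdy)) μ i ++
    C.map (block (m.eval x.length) i))))) = true

/-- Board `i` is won iff the old referee accepts board `i`'s history. [folklore] -/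
theorem win_iff (i : ℕ) : Win Ref m μ d x hdr bdy C i ↔
    boolPair x (boolPair (ones d ++ hdr) (encList (preList (m.eval x.length) (fstF bdy) (fstF (sndF bdy)) μ i ++
      C.map (block (m.eval x.length) i)))) ∈ Ref :=
  (Set.mem_iff_boolIndicator Ref _).symm

/-- The numeral value of a one-bit vote. [folklore] -/
theorem bitsToNat_encodeBool (b : Bool) : bitsToNat (encodeBool b) = if b = true then 1 else 0 := by
  cases b <;> rfl

/-- The number of boards `i < j` won. [cite: BabaiMoran1988, §2.6] -/
def winCount (j : ℕ) : ℕ :=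
  ((Finset.range j).filter fun i => Win Ref m μ d x hdr bdy C i).card

/-- `winCount (j+1) = winCount j + [Win j]`. [folklore] -/
theorem winCount_succ (j : ℕ) :
    winCount Ref m μ d x hdr bdy C (j + 1) =
      winCount Ref m μ d x hdr bdy C j + if Win Ref m μ d x hdr bdy C j then 1 else 0 := by
  classical
  unfold winCount
  rw [Finset.range_add_one, Finset.filter_insert]
  split_ifs with h
  · rw [Finset.card_insert_of_notMem (by simp)]
  · rfl

/-- `winCount j ≤ j`. [folklore] -/
theorem winCount_le (j : ℕ) : winCount Ref m μ d x hdr bdy C j ≤ j :=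
  (Finset.card_filter_le _ _).trans (Finset.card_range j).le

/-- **The loop state after `j` boards**: the count, the unread parts `U ⇂ (j+1)m`, `X ⇂ (j+1)m`
of the two special moves, and the coded list of the unread parts `· ⇂ jm` of the other moves.
[folklore] -/
def St (j : ℕ) : List Bool :=
  boolPair (encodeNat (winCount Ref m μ d x hdr bdy C j))
    (boolPair ((fstF bdy).drop ((j + 1) * m.eval x.length))
      (boolPair ((fstF (sndF bdy)).drop ((j + 1) * m.eval x.length))
        (encList (C.map fun a => a.drop (j * m.eval x.length)))))

/-- The coded prefix on a well-formed loop record. [folklore] -/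
theorem preF_apply (cnt : List Bool) (j : ℕ) :
    preF m μ (boolPair (boolPair x (boolPair hdr bdy)) (boolPair cnt (St Ref m μ d x hdr bdy C j))) =
      encList (preList (m.eval x.length) (fstF bdy) (fstF (sndF bdy)) μ j) := by
  match μ with
  | 3 => simp [preF, preList, u0F, x0F, y2F, mhatF, xF, St, nthF, block, encList_cons]
  | 4 => simp [preF, preList, u0F, x0F, y2F, z2F, mhatF, xF, St, nthF, block, encList_cons]
  | 0 => rfl
  | 1 => rfl
  | 2 => rfl
  | _ + 5 => rfl

/-- **One round of the body on the state after `j` boards gives the state after `j + 1` boards**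
(when the coded remaining moves fit into `|w|`, as they do for a genuine referee input).
[cite: BabaiMoran1988, §2.6] -/
theorem bodyF_St (cnt : List Bool) (j : ℕ)
    (hC : (encList C).length ≤ (boolPair x (boolPair hdr bdy)).length) :
    bodyF Ref m μ d (boolPair (boolPair x (boolPair hdr bdy)) (boolPair cnt (St Ref m μ d x hdr bdy C j))) =
      St Ref m μ d x hdr bdy C (j + 1) := by
  have hpre := preF_apply Ref m μ d x hdr bdy C cnt j
  -- the old referee's input for board `j`
  have harg : voteArgF m μ d (boolPair (boolPair x (boolPair hdr bdy)) (boolPair cnt (St Ref m μ d x hdr bdy C j))) =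
      boolPair x (boolPair (ones d ++ hdr) (encList (preList (m.eval x.length) (fstF bdy) (fstF (sndF bdy)) μ j ++
        C.map (block (m.eval x.length) j)))) := by
    rw [encList_append, ← hpre]
    simp [voteArgF, headsF, mhatF, xF, St, nthF, sndPow, List.map_map, Function.comp_def]
    rfl
  -- the vote
  have hvote : voteF Ref m μ d (boolPair (boolPair x (boolPair hdr bdy)) (boolPair cnt (St Ref m μ d x hdr bdy C j))) =
      encodeBool (Ref.boolIndicator (boolPair x (boolPair (ones d ++ hdr)
        (encList (preList (m.eval x.length) (fstF bdy) (fstF (sndF bdy)) μ j ++ C.map (block (m.eval x.length) j)))))) := by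
    simp only [voteF, Function.comp_apply, harg]
  -- the clipped rest
  have hrest : (encList (C.map fun a => a.drop ((j + 1) * m.eval x.length))).length ≤
      (boolPair x (boolPair hdr bdy)).length :=
    (length_encList_map_le C _ fun a => by rw [List.length_drop]; exact Nat.sub_le _ _).trans hC
  have hdrop : ∀ a : List Bool, (a.drop (j * m.eval x.length)).drop (m.eval x.length) =
      a.drop ((j + 1) * m.eval x.length) := fun a => by
    rw [List.drop_drop, Nat.succ_mul]
  have hdrop' : ∀ a : List Bool, (a.drop ((j + 1) * m.eval x.length)).drop (m.eval x.length) =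
      a.drop ((j + 1 + 1) * m.eval x.length) := fun a => by
    rw [List.drop_drop, Nat.succ_mul (j + 1)]
  simp only [bodyF, fanoutFn_apply, Function.comp_apply, hvote]
  simp only [St, mhatF, xF, nthF, sndPow, Function.comp_apply, fstF_boolPair, sndF_boolPair,
    polyFn_apply, addFn_boolPair, bitsToNat_encodeNat, dropFn_boolPair, takeFn_boolPair,
    List.length_replicate, mapDropF_apply, List.map_map, Function.comp_def, hdrop, hdrop',
    List.take_of_length_le hrest, winCount_succ, bitsToNat_encodeBool, Win]
  congr

/-- **The loop model runs through the states**: `k` more rounds from `St j` reach `St (j + k)`.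
[folklore] -/
theorem loopModel_St (hC : (encList C).length ≤ (boolPair x (boolPair hdr bdy)).length) :
    ∀ k j : ℕ, loopModel (bodyF Ref m μ d) (boolPair x (boolPair hdr bdy)) k (St Ref m μ d x hdr bdy C j) =
      St Ref m μ d x hdr bdy C (j + k)
  | 0, j => rfl
  | k + 1, j => by
    rw [loopModel, bodyF_St Ref m μ d x hdr bdy C _ j hC, loopModel_St hC k (j + 1),
      Nat.add_right_comm, Nat.add_assoc]

end Semantics

/-! ### The simulating referee -/

section Referee

variable (Ref : Language Bool) (m sB tB : Polynomial ℕ) (μ d : ℕ)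

/-- Where the coded list of the board-split moves starts in the referee input `w = ⟨x, ⟨hdr, bdy⟩⟩`:
after the two special moves (modes `3`, `4`: `sndPow 3 w`), or the whole `bdy` (`sndPow 1 w`).
[folklore] -/
def cInitF : ℕ → List Bool → List Bool
  | 3 => sndPow 3
  | 4 => sndPow 3
  | _ => sndPow 1

/-- `cInitF μ ∈ FP`. [folklore] -/
theorem cInitF_mem_FP : ∀ μ : ℕ, cInitF μ ∈ FP
  | 3 => sndPow_mem_FP 3
  | 4 => sndPow_mem_FP 3
  | 0 => sndPow_mem_FP 1
  | 1 => sndPow_mem_FP 1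
  | 2 => sndPow_mem_FP 1
  | _ + 5 => sndPow_mem_FP 1

/-- **The initial loop record** of a referee input `w = ⟨x, ⟨hdr, bdy⟩⟩`:
`⟨w, ⟨bin s(|x|), ⟨ε, ⟨bdy[0] ⇂ m, ⟨bdy[1] ⇂ m, cInit⟩⟩⟩⟩⟩`. [folklore] -/
def initF : List Bool → List Bool :=
  fanoutFn id (fanoutFn (lenBinF ∘ polyFn sB ∘ fstF)
    (fanoutFn (fun _ => [])
      (fanoutFn (dropFn ∘ fanoutFn (polyFn m ∘ fstF) (nthF 2))
        (fanoutFn (dropFn ∘ fanoutFn (polyFn m ∘ fstF) (nthF 3)) (cInitF μ)))))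

/-- `initF ∈ FP`. [folklore] -/
theorem initF_mem_FP : initF m sB μ ∈ FP :=
  fanoutFn_mem_FP (PolyTimeComputable.id _) (fanoutFn_mem_FP
    (comp_mem_FP lenBinF_mem_FP (comp_mem_FP (polyFn_mem_FP sB) fstF_mem_FP))
    (fanoutFn_mem_FP (const_mem_FP []) (fanoutFn_mem_FP
      (comp_mem_FP dropFn_mem_FP (fanoutFn_mem_FP (comp_mem_FP (polyFn_mem_FP m) fstF_mem_FP) (nthF_mem_FP 2)))
      (fanoutFn_mem_FP
        (comp_mem_FP dropFn_mem_FP (fanoutFn_mem_FP (comp_mem_FP (polyFn_mem_FP m) fstF_mem_FP) (nthF_mem_FP 3)))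
        (cInitF_mem_FP μ)))))

/-- **The run**: initialise, then `s(|w|) ≥ s(|x|)` rounds of the board loop. [cite: BabaiMoran1988, §2.6] -/
def runF : List Bool → List Bool :=
  (fun z => (loopStep (bodyF Ref m μ d))^[sB.eval (fstF z).length] z) ∘ initF m sB μ

variable {Ref} in
/-- `runF ∈ FP` for `Ref ∈ P`. [folklore] -/
theorem runF_mem_FP (hRef : Ref ∈ Classes.P) : runF Ref m sB μ d ∈ FP :=
  comp_mem_FP (loop_mem_FP m μ d hRef sB) (initF_mem_FP m sB μ)

/-- **The simulating referee**: accept iff at least `t(|x|)` of the `s(|x|)` boards are won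
(`⟨1^{t(|x|)}, count⟩ ∈ UnLe`). [cite: BabaiMoran1988, §2.6 ("declaring the winner of the
majority to be the winner")] -/
def refSim : Language Bool :=
  (fanoutFn (polyFn tB ∘ fstF) (nthF 2 ∘ runF Ref m sB μ d)) ⁻¹' UnLe

variable {Ref} in
/-- **The simulating referee is polynomial time** for `Ref ∈ P`. [cite: BabaiMoran1988, §2.5–2.6
("the new referee acts in polynomial time, using the old referee")] -/
theorem refSim_mem_P (hRef : Ref ∈ Classes.P) : refSim Ref m sB tB μ d ∈ Classes.P :=
  preimage_mem_P UnLe_mem_P (fanoutFn_mem_FP (comp_mem_FP (polyFn_mem_FP tB) fstF_mem_FP)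
    (comp_mem_FP (nthF_mem_FP 2) (runF_mem_FP m sB μ d hRef)))

/-- **Semantics of the simulating referee** on an input `⟨x, ⟨hdr, bdy⟩⟩` whose coded list of
board-split moves is `encList C`: accept iff at least `t(|x|)` of the boards `i < s(|x|)` are won.
[cite: BabaiMoran1988, §2.6] -/
theorem mem_refSim_iff (x hdr bdy : List Bool) (C : List (List Bool))
    (hinit : cInitF μ (boolPair x (boolPair hdr bdy)) = encList C)
    (hC : (encList C).length ≤ (boolPair x (boolPair hdr bdy)).length) :
    boolPair x (boolPair hdr bdy) ∈ refSim Ref m sB tB μ d ↔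
      tB.eval x.length ≤ winCount Ref m μ d x hdr bdy C (sB.eval x.length) := by
  set w := boolPair x (boolPair hdr bdy) with hw
  -- the initial record is `⟨w, ⟨bin s(|x|), St 0⟩⟩`
  have hI : initF m sB μ w = boolPair w (boolPair (encodeNat (sB.eval x.length)) (St Ref m μ d x hdr bdy C 0)) := by
    have h2 : nthF 2 w = fstF bdy := by simp [hw, nthF]
    have h3 : nthF 3 w = fstF (sndF bdy) := by simp [hw, nthF]
    have h0 : encodeNat 0 = [] := rfl
    simp only [initF, fanoutFn_apply, Function.comp_apply, id, hinit, h2, h3]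
    simp [hw, St, winCount, lenBinF_apply, ones, h0]
  -- the run ends in `⟨w, ⟨ε, St (s |x|)⟩⟩`
  have hrun : runF Ref m sB μ d w = boolPair w (boolPair [] (St Ref m μ d x hdr bdy C (sB.eval x.length))) := by
    have hrounds : sB.eval x.length ≤ sB.eval w.length :=
      TM2Iter.eval_mono sB (by rw [hw, length_boolPair, length_boolPair]; omega)
    simp only [runF, Function.comp_apply]
    rw [hI, fstF_boolPair, iterate_loopStep _ w _ _ _ hrounds, loopModel_St Ref m μ d x hdr bdy C hC, Nat.zero_add]
  show fanoutFn (polyFn tB ∘ fstF) (nthF 2 ∘ runF Ref m sB μ d) w ∈ UnLe ↔ _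
  rw [fanoutFn_apply, Function.comp_apply, Function.comp_apply, hrun]
  simp [hw, nthF, boolPair_mem_UnLe, ones, St]

/-- **The simulating referee on a genuine history, plain mode** (`μ = 0`: every move is split
into boards, e.g. three-board amplification): `⟨x, enc H⟩` is accepted iff at least `t(|x|)` of
the boards `i < s(|x|)` — the old referee run on `⟨x, ⟨1ᵈ 1^{|H|}, encList (H.map (block i))⟩⟩` —
are won. [cite: BabaiMoran1988, §2.6] -/
theorem mem_refSim_zero_iff (x : List Bool) (H : List (List Bool)) :
    boolPair x (encMoves H) ∈ refSim Ref m sB tB 0 d ↔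
      tB.eval x.length ≤ ((Finset.range (sB.eval x.length)).filter fun i =>
        boolPair x (boolPair (ones d ++ ones H.length) (encList (H.map (block (m.eval x.length) i)))) ∈ Ref).card := by
  rw [encMoves_eq, mem_refSim_iff Ref m sB tB 0 d x (ones H.length) (encList H) H (by simp [cInitF])
    (by rw [length_boolPair, length_boolPair]; omega)]
  unfold winCount
  rw [Finset.filter_congr fun i _ => win_iff Ref m 0 d x (ones H.length) (encList H) H i]
  rfl

/-- **The simulating referee on a genuine history, switch modes** (`μ = 3, 4`: the first two
moves `U`, `X` are special): `⟨x, enc (U :: X :: C)⟩` is accepted iff at least `t(|x|)` of the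
boards `i < s(|x|)` — the old referee run on
`⟨x, ⟨1ᵈ 1^{|C|+2}, encList (preList_i ++ C.map (block i))⟩⟩` — are won. [cite: BabaiMoran1988, §3] -/
theorem mem_refSim_special_iff (hμ : μ = 3 ∨ μ = 4) (x U X : List Bool) (C : List (List Bool)) :
    boolPair x (encMoves (U :: X :: C)) ∈ refSim Ref m sB tB μ d ↔
      tB.eval x.length ≤ ((Finset.range (sB.eval x.length)).filter fun i =>
        boolPair x (boolPair (ones d ++ ones (C.length + 2))
          (encList (preList (m.eval x.length) U X μ i ++ C.map (block (m.eval x.length) i)))) ∈ Ref).card := by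
  have hinit : cInitF μ (boolPair x (boolPair (ones (C.length + 2)) (boolPair U (boolPair X (encList C))))) =
      encList C := by
    rcases hμ with rfl | rfl <;> simp [cInitF, sndPow]
  rw [encMoves_eq, List.length_cons, List.length_cons, encList_cons, encList_cons,
    mem_refSim_iff Ref m sB tB μ d x (ones (C.length + 2)) _ C hinit
      (by simp only [length_boolPair]; omega)]
  unfold winCount
  rw [Finset.filter_congr fun i _ => win_iff Ref m μ d x (ones (C.length + 2)) _ C i]
  simp only [fstF_boolPair, sndF_boolPair]

end Referee

end Boards

end Literature.Computability.Complexity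

end
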